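import Mathlib.Analysis.Fourier.FourierTransform
import Mathlib.Analysis.Fourier.Inversion
import Mathlib.Analysis.Distribution.SchwartzSpace.Basic
import Mathlib.MeasureTheory.Integral.IntervalIntegral.Basic
import Literature.Analysis.FluidPDE.VectorCalculus
import Literature.Analysis.FluidPDE.MildSolution
import Literature.Analysis.UnboundedOperators.HeatKernel
import Literature.Analysis.FunctionSpaces.Complexify
import HarnessLib

-- provenance: harness21/H21/H21/Prelude/FluidKinetic/TaoAveragedEuler.lean @ 99cb807 (interim HEAD d8f2665); M5 mechanical rewrite
/-!
# Tao's averaged Euler bilinear operators and the averaged Navier–Stokes equation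

Trunk: FluidKinetic (outline `H21/Outlines/FluidKinetic.md`, item F15 `TaoAveragedEuler`,
**risk-flagged**; notion `averaged_bilinear_operator_tao`). Everything specific to Tao lives on
`ℝ³ = EuclideanSpace ℝ (Fin 3)`; the function-level Fourier-multiplier glue is written for
`EuclideanSpace ℝ ι`.

Following T. Tao, *Finite time blowup for an averaged three-dimensional Navier–Stokes equation*,
J. Amer. Math. Soc. 29 (2016), 601–674 (arXiv:1402.0290), §1:

* the Navier–Stokes system (viscosity `ν = 1`, projected form) is `∂ₜu = Δu + B(u,u)` with the
  **Euler bilinear operator** `B(u,v) = -½ P[(u·∇)v + (v·∇)u]` (Tao (1.8)), `P` the Leray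
  projector;
* a **Fourier multiplier of order `0`** (Tao Def. 1.1) is `m(D)`, `\widehat{m(D)u} = m û`, with a
  symbol `m` smooth away from the origin and `|∇ʲ m(ξ)| ≤ Cⱼ |ξ|^{-j}`;
* an **averaged Euler bilinear operator** (Tao Def. 1.2, (1.10)) is defined by duality,
  `⟨B̃(u,v), w⟩ = 𝔼 ⟨B(m₁(D) Rot_{R₁} Dil_{λ₁} u, m₂(D) Rot_{R₂} Dil_{λ₂} v), m₃(D) Rot_{R₃} Dil_{λ₃} w⟩`
  with random order-`0` multipliers `mᵢ(D)`, random rotations `Rot_R u (x) = R u(R⁻¹x)` and random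
  dilations `Dil_λ u (x) = λ^{σ} u(λx)` (Tao (1.9); the normalising exponent, `σ = 3/2` making
  `Dil_λ` unitary on `L²(ℝ³)`, is **unverified at source ('?', outline §4.9)** and kept as a
  parameter `σ`);
* the **cancellation property** `⟨B̃(u,u), u⟩ = 0` (Tao (1.11)) and **mild solutions**
  `u(t) = e^{tΔ}u₀ + ∫₀ᵗ e^{(t-s)Δ} B̃(u(s),u(s)) ds` in `H¹⁰_df(ℝ³)` (Tao Def. 1.3, (1.12));
* Tao's Thm. 1.4 (blow-up for some such `B̃`) is stated downstream (`Statements/NS/TaoAveraged`).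

## Mathlib search

Mathlib (this pin) has the Fourier integral on functions `V → E` over a finite-dimensional real
inner product space with the notation `𝓕`, `𝓕⁻` (`Real.instFourierTransform`,
`Mathlib/Analysis/Fourier/FourierTransform.lean`), Fourier inversion for continuous integrable
functions (`Continuous.fourierInv_fourier_eq`), the Schwartz space `𝓢(E, F)`
(`Mathlib/Analysis/Distribution/SchwartzSpace/Basic.lean`) and Fourier multipliers **on tempered
distributions / Schwartz space only** (`SchwartzMap.fourierMultiplierCLM`,
`Mathlib/Analysis/Distribution/`). It has no order-`0` symbol class (searched `Symbol`,
`Mikhlin`, `Hormander`, `multiplier`), no rotation/dilation action on vector fields, no Leray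
projector and nothing on Navier–Stokes. We use `𝓕`/`𝓕⁻` on plain functions
`EuclideanSpace ℝ ι → EuclideanSpace ℂ ι`, the accepted complexification
`Literature.Analysis.FunctionSpaces.EuclideanSpace.complexify` (G03), `iteratedFDeriv`, `LinearIsometryEquiv`, the Bochner
integral over a probability space, `intervalIntegral`, `MemLp`, and from H21 `Fluid.convect`,
`Fluid.IsDivFree` (F1), `Fluid.heatFlow` (F8, built on `heatExtension`, G07),
`Fluid.lerayProjector` (F6, for the bridge lemma), `IsTestFunctionOn` (G03).

## Design notes (risk flags)

* **Function-level multipliers, Bochner junk.** `multiplierApply m u = Re 𝓕⁻(m · 𝓕(uℂ))` is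
  defined for *every* `u` through Bochner integrals; it is the honest operator `m(D)u` when `u`
  is Schwartz (or merely `u, m û ∈ L¹ ∩ C⁰`), and **junk** (whatever the non-convergent Bochner
  integrals return, typically `0`) otherwise. Every definition built from it (`lerayProjFun`,
  `eulerBilinear`, `TaoAverageData.op`) inherits this caveat, repeated in each docstring. The
  real part `realPart` is taken because symbols are real-valued functions `m : ℝ³ → ℝ`; for a
  real field `u` and an *even* real symbol, `𝓕⁻(m 𝓕 uℂ)` is already real and `realPart` is
  harmless; for non-even `m` it replaces `m` by its even part (documented junk).
* **Composition order (Tao Def. 1.2).** We follow the duality formula literally with *three*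
  jointly random triples `(mᵢ, Rᵢ, λᵢ)`, `i : Fin 3`, on one probability space: writing
  `Aᵢ = mᵢ(D) ∘ Rot_{Rᵢ} ∘ Dil_{λᵢ}` (dilate first, then rotate, then multiply),
  `B̃(u,v) = 𝔼[A₃† B(A₁u, A₂v)]` where `A₃† = Dil_{λ₃}† ∘ Rot_{R₃⁻¹} ∘ m₃(D)` is the formal `L²`
  adjoint (`m(D)† = m(D)` for real `m`, `Rot_R† = Rot_{R⁻¹}`, `Dil_λ† = λ^{2σ-3} Dil_{λ⁻¹}` on
  `ℝ³`; for `σ = 3/2` the prefactor is `1`). The outline's single-`(R, λ)` version is the special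
  case `R₁ = R₂ = R₃`, `λ₁ = λ₂ = λ₃`. Tao's moment/integrability conditions on the random
  symbols ('?', not verified at source) are **not** encoded: where `θ ↦ (A₃† B(A₁u, A₂v))(x)` is
  not Bochner integrable the expectation is the junk value `0`. Measurability of the random data
  is recorded as structure fields. (Sample points are written `θ`, since `ω` is taken by an
  ordinal notation in scope.)
* **`t = 0` (review finding 1).** Mild solutions use `Fluid.heatFlow` (`e^{0Δ} = id`), not raw
  `heatExtension` (whose value at `t = 0` is the junk `0`); at `t = 0` the mild identity reads
  `u 0 = u₀` (`isAveragedNSMildSolutionOn_zero_iff`).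
* `IsSchwartzField u` is membership in the range of Mathlib's `SchwartzMap` coercion; the
  outline's explicit form is `isSchwartzField_iff`.

## References

* T. Tao, *Finite time blowup for an averaged three-dimensional Navier–Stokes equation*,
  J. Amer. Math. Soc. 29 (2016), 601–674, Def. 1.1–1.3, (1.8)–(1.12), Thm. 1.4.
* P. G. Lemarié-Rieusset, *Recent developments in the Navier–Stokes problem* (2002), Ch. 11
  (Leray projector as the multiplier `I − ξ ⊗ ξ/|ξ|²`).
-/

noncomputable section

open MeasureTheory TopologicalSpace Set Function Filter Topology FourierTransform
open scoped InnerProductSpace RealInnerProductSpace ENNReal NNReal ContDiff SchwartzMap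

namespace Literature.Analysis.FluidPDE

/-! ### Function-level Fourier multipliers on `EuclideanSpace ℝ ι` -/

section Multiplier

variable {ι : Type*}

/-- The coordinatewise real part `ℂ^ι → ℝ^ι`, `w ↦ (i ↦ Re (w i))`, left inverse of the accepted
complexification `EuclideanSpace.complexify` (`realPart_complexify`). Used to return from complex
Fourier analysis to real vector fields (Tao 2016, §1, real vector fields throughout). [cite: Tao2016, §1  real vector fields throughout] -/
def realPart (w : EuclideanSpace ℂ ι) : EuclideanSpace ℝ ι :=
  WithLp.toLp 2 fun i => (w i).re

/-- Coordinates of the real part. [folklore] -/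
@[simp]
theorem realPart_apply (w : EuclideanSpace ℂ ι) (i : ι) : realPart w i = (w i).re := rfl

variable [Fintype ι]

/-- `realPart` is a left inverse of `complexify`: `Re (v i : ℂ) = v i`. [folklore] -/
@[simp]
theorem realPart_complexify (v : EuclideanSpace ℝ ι) :
    realPart (FunctionSpaces.EuclideanSpace.complexify v) = v := by
  ext i
  simp [realPart]

/-- The (vector) **Fourier transform of a real vector field** `u : ℝ^ι → ℝ^ι`, taken
componentwise over `ℂ`: `û = 𝓕 (complexify ∘ u) : ℝ^ι → ℂ^ι` (Mathlib's Fourier integral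
`Real.instFourierTransform`, normalisation `∫ e^{-2πi⟪x,ξ⟫} u(x) dx`). **Junk** (Bochner) unless
`u ∈ L¹`. Tao 2016, §1 (notation `û`). [cite: Tao2016, §1 (notation  û] -/
def fourierVec (u : EuclideanSpace ℝ ι → EuclideanSpace ℝ ι) :
    EuclideanSpace ℝ ι → EuclideanSpace ℂ ι :=
  𝓕 (FunctionSpaces.EuclideanSpace.complexify ∘ u)

/-- The **Fourier multiplier** `m(D)` with real symbol `m` acting on real vector fields,
`m(D) u = Re 𝓕⁻ (ξ ↦ m(ξ) û(ξ))` (Tao 2016, Def. 1.1: `\widehat{m(D)u}(ξ) = m(ξ) û(ξ)`).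
Function-level definition through Bochner integrals: honest for Schwartz `u` and order-`0`
symbols `m` (then `m û ∈ L¹`), **junk** otherwise; the real part discards the (vanishing, for even
`m`) imaginary part — see the module docstring. [cite: Tao2016, Def. 1.1:  \widehat{m(D] -/
def multiplierApply (m : EuclideanSpace ℝ ι → ℝ) (u : EuclideanSpace ℝ ι → EuclideanSpace ℝ ι) :
    EuclideanSpace ℝ ι → EuclideanSpace ℝ ι :=
  fun x => realPart (𝓕⁻ (fun ξ => (m ξ : ℂ) • fourierVec u ξ) x)

/-- **Symbols of order `0`** (Tao 2016, Def. 1.1; Hörmander–Mikhlin class): `m` is smooth away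
from the origin and `‖∇ʲ m(ξ)‖ ≤ Cⱼ ‖ξ‖^{-j}` for all `j : ℕ` and `ξ ≠ 0`. The value `m 0` is
irrelevant (a null set on the Fourier side). [cite: Tao2016, Def. 1.1] -/
def IsOrderZeroSymbol (m : EuclideanSpace ℝ ι → ℝ) : Prop :=
  ContDiffOn ℝ ∞ m {0}ᶜ ∧
    ∀ j : ℕ, ∃ C : ℝ, ∀ ξ, ξ ≠ 0 → ‖iteratedFDeriv ℝ j m ξ‖ ≤ C * ‖ξ‖⁻¹ ^ j

/-- The complexified **Leray symbol** `P̂(ξ) c = c − (ξ·c / |ξ|²) ξ` acting on a complex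
frequency vector `c : ℂ^ι` (Lemarié-Rieusset 2002, Ch. 11; Tao 2016, §1, `P` the Leray
projection onto divergence-free fields); the complex-linear extension of the accepted real
`Fluid.leraySymbol ξ`. **Junk value** at `ξ = 0`: division by `0` gives `leraySymbolC 0 c = c`. [cite: LemarieRieusset2002, Ch. 11] -/
def leraySymbolC (ξ : EuclideanSpace ℝ ι) (c : EuclideanSpace ℂ ι) : EuclideanSpace ℂ ι :=
  c - ((∑ i, (ξ i : ℂ) * c i) / ((‖ξ‖ ^ 2 : ℝ) : ℂ)) • FunctionSpaces.EuclideanSpace.complexify ξ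

/-- At `ξ = 0` the complexified Leray symbol is the identity (documented junk value). [folklore] -/
@[simp]
theorem leraySymbolC_zero (c : EuclideanSpace ℂ ι) : leraySymbolC (0 : EuclideanSpace ℝ ι) c = c := by
  simp [leraySymbolC]

/-- The **Leray projector on functions**, `P u = Re 𝓕⁻ (ξ ↦ P̂(ξ) û(ξ))` with
`P̂(ξ) = I − ξ ⊗ ξ/|ξ|²` (Lemarié-Rieusset 2002, Ch. 11; Tao 2016, (1.8)). Function-level
(Bochner) definition: honest for Schwartz `u` (then `P̂ û ∈ L¹`), **junk** otherwise; agrees a.e.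
with the accepted `L²` Leray projector on test fields (`lerayProjFun_ae_eq_lerayProjector`). [cite: LemarieRieusset2002, Ch. 11] -/
def lerayProjFun (u : EuclideanSpace ℝ ι → EuclideanSpace ℝ ι) :
    EuclideanSpace ℝ ι → EuclideanSpace ℝ ι :=
  fun x => realPart (𝓕⁻ (fun ξ => leraySymbolC ξ (fourierVec u ξ)) x)

/-- The **rotation action** on vector fields, `Rot_R u (x) = R (u (R⁻¹ x))` for a linear isometry
`R` of `ℝ^ι` (Tao 2016, Def. 1.2; orthogonal transformations, including reflections). [cite: Tao2016, Def. 1.2] -/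
def rotateField (R : EuclideanSpace ℝ ι ≃ₗᵢ[ℝ] EuclideanSpace ℝ ι)
    (u : EuclideanSpace ℝ ι → EuclideanSpace ℝ ι) : EuclideanSpace ℝ ι → EuclideanSpace ℝ ι :=
  fun x => R (u (R.symm x))

/-- The **dilation action** on vector fields, `Dil_λ u (x) = λ^σ u (λ x)` (Tao 2016, (1.9),
`Dil_λ`). The normalising exponent `σ` is a parameter: Tao's value (`σ = 3/2`, the `L²(ℝ³)`-unitary
normalisation) is **unverified at source ('?', outline §4.9)**. Intended for `0 < λ`; for `λ ≤ 0`
the real power `λ ^ σ` is Mathlib's junk `Real.rpow`. [cite: Tao2016, (1.9] -/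
def dilateField (σ lam : ℝ) (u : EuclideanSpace ℝ ι → EuclideanSpace ℝ ι) :
    EuclideanSpace ℝ ι → EuclideanSpace ℝ ι :=
  fun x => lam ^ σ • u (lam • x)

/-- The **Euler bilinear operator** `B(u,v) = -½ P[(u·∇)v + (v·∇)u]` (Tao 2016, (1.8)), the
symmetrised, Leray-projected Navier–Stokes nonlinearity, so that (projected) Navier–Stokes reads
`∂ₜu = Δu + B(u,u)`. Here `convect u v = (u·∇)v` is the accepted convective derivative and `P` is
the function-level `lerayProjFun` (**junk** off the Schwartz class; for Schwartz `u v` the result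
is smooth with `L²` derivatives, `contDiff_eulerBilinear`, and for divergence-free ones moreover
`O(|x|^{-d-1})`, hence integrable). [cite: Tao2016, (1.8] -/
def eulerBilinear (u v : EuclideanSpace ℝ ι → EuclideanSpace ℝ ι) :
    EuclideanSpace ℝ ι → EuclideanSpace ℝ ι :=
  -(2 : ℝ)⁻¹ • lerayProjFun (fun x => convect u v x + convect v u x)

/-- A real vector field is of **Schwartz class**: it is (the coercion of) an element of Mathlib's
Schwartz space `𝓢(ℝ^ι, ℝ^ι)`; equivalently (`isSchwartzField_iff`) smooth with
`‖x‖ᵏ ‖∇ⁿu(x)‖` bounded for all `k n` (Tao 2016, Thm. 1.4: "Schwartz divergence-free `u₀`"). [cite: Tao2016, Thm. 1.4: "Schwartz divergence-free  u₀] -/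
def IsSchwartzField (u : EuclideanSpace ℝ ι → EuclideanSpace ℝ ι) : Prop :=
  ∃ f : 𝓢(EuclideanSpace ℝ ι, EuclideanSpace ℝ ι), ⇑f = u

/-! ### API for the function-level operators -/

/-- `IsSchwartzField` unfolded to the outline's explicit form: smooth with all Schwartz
seminorms `sup ‖x‖ᵏ ‖∇ⁿ u(x)‖` finite (Mathlib `SchwartzMap.smooth'`, `SchwartzMap.decay'`). [folklore] -/
theorem isSchwartzField_iff (u : EuclideanSpace ℝ ι → EuclideanSpace ℝ ι) :
    IsSchwartzField u ↔ ContDiff ℝ ∞ u ∧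
      ∀ k n : ℕ, ∃ C : ℝ, ∀ x, ‖x‖ ^ k * ‖iteratedFDeriv ℝ n u x‖ ≤ C := by
  constructor
  · rintro ⟨f, rfl⟩
    exact ⟨f.smooth', f.decay'⟩
  · rintro ⟨h₁, h₂⟩
    exact ⟨⟨u, h₁, h₂⟩, rfl⟩

/-- **Symmetry of the Euler bilinear operator**: `B(u,v) = B(v,u)` (Tao 2016, (1.8), by
construction). [cite: Tao2016, (1.8] -/
theorem eulerBilinear_symm (u v : EuclideanSpace ℝ ι → EuclideanSpace ℝ ι) :
    eulerBilinear u v = eulerBilinear v u := by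
  unfold eulerBilinear
  congr 2
  funext x
  exact add_comm _ _

/-- The trivial multiplier `m ≡ 1` is the identity on continuous integrable fields with
integrable Fourier transform (Fourier inversion, Mathlib `Continuous.fourierInv_fourier_eq`; in
particular on Schwartz fields). Sanity check that `multiplierApply` is not junk there. [folklore] -/
theorem multiplierApply_one {u : EuclideanSpace ℝ ι → EuclideanSpace ℝ ι} (hu : Continuous u)
    (hi : Integrable u) (hF : Integrable (fourierVec u)) :
    multiplierApply (fun _ => 1) u = u := by
  have hc : Continuous (FunctionSpaces.EuclideanSpace.complexify ∘ u) :=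
    FunctionSpaces.EuclideanSpace.continuous_complexify.comp hu
  have hci : Integrable (FunctionSpaces.EuclideanSpace.complexify ∘ u) :=
    FunctionSpaces.EuclideanSpace.complexify.toContinuousLinearMap.integrable_comp hi
  have h := hc.fourierInv_fourier_eq hci hF
  funext x
  simp only [multiplierApply, Complex.ofReal_one, one_smul]
  change realPart (𝓕⁻ (fourierVec u) x) = u x
  rw [fourierVec, h, Function.comp_apply, realPart_complexify]

/-- The multiplier `m(D)` depends on the symbol only through its values off the origin:
symbols agreeing on `{0}ᶜ` define the same operator (the Fourier-side integrands agree a.e.),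
which is why `IsOrderZeroSymbol` ignores `m 0` (Tao 2016, Def. 1.1). (`ι` nonempty: for empty
`ι` frequency space is the point `{0}`, of mass `1`.) [cite: Tao2016, Def. 1.1] -/
theorem multiplierApply_congr_off_zero [Nonempty ι] {m m' : EuclideanSpace ℝ ι → ℝ}
    (h : ∀ ξ, ξ ≠ 0 → m ξ = m' ξ) (u : EuclideanSpace ℝ ι → EuclideanSpace ℝ ι) :
    multiplierApply m u = multiplierApply m' u := by
  funext x
  simp only [multiplierApply, Real.fourierInv_eq]
  congr 1
  refine integral_congr_ae ?_
  filter_upwards [compl_mem_ae_iff.mpr (measure_singleton (0 : EuclideanSpace ℝ ι))] with ξ hξ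
  rw [h ξ hξ]

/-- **`P` kills nothing on divergence-free Schwartz fields**: `lerayProjFun u = u` for Schwartz
divergence-free `u` (`ξ · û(ξ) = 0`, so `P̂(ξ)û(ξ) = û(ξ)`; Lemarié-Rieusset 2002, Ch. 11). [cite: LemarieRieusset2002, Ch. 11] -/
def lerayProjFun_eq_self_of_isDivFree : Prop :=
  ∀ {u : EuclideanSpace ℝ ι → EuclideanSpace ℝ ι} (hu : IsSchwartzField u) (hdiv : VectorCalculus.IsDivFree u),
    lerayProjFun u = u

/-- **Bridge to the accepted `L²` Leray projector** (Lemarié-Rieusset 2002, Ch. 11: `P` is the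
Fourier multiplier `I − ξ ⊗ ξ/|ξ|²`; cf. the accepted `fourier_lerayProjector_schwartz`): for
`v ∈ L²` with a test-function representative `φ`, the accepted `Fluid.lerayProjector _ v` is
represented a.e. by the function-level `lerayProjFun φ`. [cite: LemarieRieusset2002, Ch. 11:  P  is the Fourier multiplier  I] -/
def lerayProjFun_ae_eq_lerayProjector : Prop :=
  ∀ {v : Lp (EuclideanSpace ℝ ι) 2 (volume : Measure (EuclideanSpace ℝ ι))} {φ : EuclideanSpace ℝ ι → EuclideanSpace ℝ ι} (hφ : FunctionSpaces.IsTestFunctionOn (⊤ : Opens (EuclideanSpace ℝ ι)) φ) (hv : (v : EuclideanSpace ℝ ι → EuclideanSpace ℝ ι) =ᵐ[volume] φ),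
    ((lerayProjector (EuclideanSpace ℝ ι) v : Lp (EuclideanSpace ℝ ι) 2
        (volume : Measure (EuclideanSpace ℝ ι))) : EuclideanSpace ℝ ι → EuclideanSpace ℝ ι)
      =ᵐ[volume] lerayProjFun φ

/-- The Euler bilinear operator of Schwartz fields is smooth, and square integrable with all
derivatives (it is `-½ P` of a Schwartz field; `P` preserves `H^k` but not the Schwartz class,
because `P̂` is singular at `ξ = 0`). Tao 2016, §1 (`B : H¹⁰_df × H¹⁰_df → (H¹⁰_df)*` and
better on Schwartz data). [cite: Tao2016, §1 ( B : H¹⁰_df × H¹⁰_df → (H¹⁰_df] -/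
def contDiff_eulerBilinear : Prop :=
  ∀ {u v : EuclideanSpace ℝ ι → EuclideanSpace ℝ ι} (hu : IsSchwartzField u) (hv : IsSchwartzField v),
    ContDiff ℝ ∞ (eulerBilinear u v) ∧
      ∀ n : ℕ, MemLp (iteratedFDeriv ℝ n (eulerBilinear u v)) 2
        (volume : Measure (EuclideanSpace ℝ ι))

end Multiplier

/-! ### Cancellation, regularity class, mild solutions -/

section Classes

variable {ι : Type*} [Fintype ι]

/-- The **cancellation property** `⟨B(u,u), u⟩_{L²} = 0` (Tao 2016, (1.11)) of a bilinear
operator on vector fields, required on Schwartz divergence-free `u` (where the function-level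
operators of this file are honest; Tao asks it on `H¹⁰_df`, which for his bounded operators
`B̃ : H¹⁰_df × H¹⁰_df → (H¹⁰_df)*` is equivalent by density). [cite: Tao2016, (1.11] -/
def HasCancellation
    (B : (EuclideanSpace ℝ ι → EuclideanSpace ℝ ι) → (EuclideanSpace ℝ ι → EuclideanSpace ℝ ι) →
      EuclideanSpace ℝ ι → EuclideanSpace ℝ ι) : Prop :=
  ∀ u, IsSchwartzField u → VectorCalculus.IsDivFree u → ∫ x, ⟪B u u x, u x⟫ = 0

/-- The regularity class **`H¹⁰_df`** of Tao 2016, §1 (Def. 1.3, Thm. 1.4), for everywhere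
defined fields: `u` is `C¹⁰`, all derivatives of order `≤ 10` are square integrable, and
`div u = 0` pointwise. (Tao's `H¹⁰_df(ℝ³)` is the Sobolev space of `L²` classes; on `C¹⁰`
representatives the two notions of the norm agree.) [cite: Tao2016, §1 (Def. 1.3  Thm. 1.4] -/
def MemH10DivFree (u : EuclideanSpace ℝ ι → EuclideanSpace ℝ ι) : Prop :=
  ContDiff ℝ 10 u ∧
    (∀ n : ℕ, n ≤ 10 → MemLp (iteratedFDeriv ℝ n u) 2 (volume : Measure (EuclideanSpace ℝ ι))) ∧
      VectorCalculus.IsDivFree u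

/-- **Mild solutions of the (averaged) Navier–Stokes equation `∂ₜu = Δu + B(u,u)`** on a time
set `S` (Tao 2016, Def. 1.3, (1.12), viscosity `ν = 1`), pointwise Duhamel form:
`u t x = (e^{tΔ}u₀)(x) + ∫₀ᵗ (e^{(t-s)Δ} B(u s, u s))(x) ds` for all `t ∈ S` and all `x`.
The heat semigroup is the accepted `Fluid.heatFlow` (`e^{0Δ} = id`, **not** raw `heatExtension`,
whose value at time `0` is junk), so at `t = 0` the identity is `u 0 = u₀`
(`isAveragedNSMildSolutionOn_zero_iff`). The regularity class (`MemH10DivFree`, continuity in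
time) is imposed separately in the statements. [cite: Tao2016, Def. 1.3  (1.12] -/
def IsAveragedNSMildSolutionOn (S : Set ℝ)
    (B : (EuclideanSpace ℝ ι → EuclideanSpace ℝ ι) → (EuclideanSpace ℝ ι → EuclideanSpace ℝ ι) →
      EuclideanSpace ℝ ι → EuclideanSpace ℝ ι)
    (u₀ : EuclideanSpace ℝ ι → EuclideanSpace ℝ ι) (u : ℝ → EuclideanSpace ℝ ι → EuclideanSpace ℝ ι) :
    Prop :=
  ∀ t ∈ S, ∀ x, u t x = heatFlow u₀ t x + ∫ s in 0..t, heatFlow (B (u s) (u s)) (t - s) x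

/-- **Sanity check at `t = 0`**: the mild identity at time `0` is exactly `u 0 = u₀`
(`e^{0Δ} = id`, empty time integral). [folklore] -/
theorem isAveragedNSMildSolutionOn_zero_iff
    (B : (EuclideanSpace ℝ ι → EuclideanSpace ℝ ι) → (EuclideanSpace ℝ ι → EuclideanSpace ℝ ι) →
      EuclideanSpace ℝ ι → EuclideanSpace ℝ ι)
    (u₀ : EuclideanSpace ℝ ι → EuclideanSpace ℝ ι)
    (u : ℝ → EuclideanSpace ℝ ι → EuclideanSpace ℝ ι) :
    IsAveragedNSMildSolutionOn {0} B u₀ u ↔ u 0 = u₀ := by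
  simp [IsAveragedNSMildSolutionOn, funext_iff]

/-- Mild solutions restrict to smaller time sets. [folklore] -/
theorem IsAveragedNSMildSolutionOn.mono {S S' : Set ℝ}
    {B : (EuclideanSpace ℝ ι → EuclideanSpace ℝ ι) → (EuclideanSpace ℝ ι → EuclideanSpace ℝ ι) →
      EuclideanSpace ℝ ι → EuclideanSpace ℝ ι}
    {u₀ : EuclideanSpace ℝ ι → EuclideanSpace ℝ ι} {u : ℝ → EuclideanSpace ℝ ι → EuclideanSpace ℝ ι}
    (h : IsAveragedNSMildSolutionOn S B u₀ u) (hS : S' ⊆ S) : IsAveragedNSMildSolutionOn S' B u₀ u :=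
  fun t ht => h t (hS ht)

/-- **Cancellation for the Euler bilinear operator** (Tao 2016, (1.11) for `B` itself; the
classical energy identity `∫ ⟪P[(u·∇)u], u⟫ = ∫ ⟪(u·∇)u, u⟫ = 0` for Schwartz divergence-free
`u`, since `P u = u` and `∫ ⟪(u·∇)u, u⟫ = ½ ∫ u·∇|u|² = -½ ∫ (div u)|u|² = 0`). [cite: Tao2016, (1.11] -/
def hasCancellation_eulerBilinear : Prop :=
  HasCancellation (eulerBilinear (ι := ι))

end Classes

/-! ### Tao's averaged Euler bilinear operators on `ℝ³` -/

section Tao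

/-- Local notation for physical space `ℝ³`. -/
local notation "ℝ³" => EuclideanSpace ℝ (Fin 3)

/-- **Tao's averaging datum** (Tao 2016, Def. 1.2): a probability space `(Ω, ℙ)` carrying, for
each slot `i : Fin 3` of the duality formula (1.10), a random real symbol `m i θ` of order `0`, a
random linear isometry ("rotation") `R i θ` of `ℝ³` and a random dilation factor `lam i θ > 0`,
all jointly measurable in `(θ, x)`; together with the dilation-normalising exponent `σ`
(Tao (1.9); `σ = 3/2` **'?' unverified**, outline §4.9). A *hypothesis structure* (outline §5.1):
Tao's moment conditions on the symbol seminorms ('?') are not encoded. The universe of `Ω` is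
fixed to `Type` so that `∃ 𝒜 : TaoAverageData, …` is a small proposition. [cite: Tao2016, Def. 1.2] -/
structure TaoAverageData where
  /-- The sample space. -/
  Ω : Type
  /-- Its σ-algebra. -/
  [mΩ : MeasurableSpace Ω]
  /-- The probability law of the random data. -/
  P : Measure Ω
  [prob : IsProbabilityMeasure P]
  /-- The dilation-normalising exponent (`Dil_λ u (x) = λ^σ u(λx)`; Tao: `3/2` '?'). -/
  σ : ℝ
  /-- The three random real Fourier symbols of order `0`. -/
  m : Fin 3 → Ω → ℝ³ → ℝ
  /-- The three random rotations. -/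
  R : Fin 3 → Ω → (ℝ³ ≃ₗᵢ[ℝ] ℝ³)
  /-- The three random dilation factors. -/
  lam : Fin 3 → Ω → ℝ
  isOrderZeroSymbol : ∀ i θ, IsOrderZeroSymbol (m i θ)
  lam_pos : ∀ i θ, 0 < lam i θ
  measurable_m : ∀ i, Measurable (uncurry (m i))
  measurable_R : ∀ i, Measurable fun p : Ω × ℝ³ => R i p.1 p.2
  measurable_lam : ∀ i, Measurable (lam i)

attribute [instance] TaoAverageData.mΩ TaoAverageData.prob

namespace TaoAverageData

variable (𝒜 : TaoAverageData)

/-- The random operator `Aᵢ(θ) = mᵢ(D) ∘ Rot_{Rᵢ} ∘ Dil_{λᵢ}` of slot `i` (Tao 2016, (1.10):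
dilate first, then rotate, then apply the multiplier). **Junk** off the Schwartz class
(function-level multiplier). [cite: Tao2016, (1.10] -/
def slot (i : Fin 3) (θ : 𝒜.Ω) (u : ℝ³ → ℝ³) : ℝ³ → ℝ³ :=
  multiplierApply (𝒜.m i θ) (rotateField (𝒜.R i θ) (dilateField 𝒜.σ (𝒜.lam i θ) u))

/-- The formal `L²(ℝ³)` adjoint `Aᵢ(θ)† = Dil_{λᵢ}† ∘ Rot_{Rᵢ⁻¹} ∘ mᵢ(D)` of `slot`, with
`Dil_λ† = λ^{2σ-3} Dil_{λ⁻¹}` (change of variables in `ℝ³`; prefactor `1` for `σ = 3/2`),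
`Rot_R† = Rot_{R⁻¹}` and `m(D)† = m(D)` for a real symbol. Used to turn Tao's duality definition
(1.10) into a pointwise one. **Junk** off the Schwartz class. [folklore] -/
def slotAdjoint (i : Fin 3) (θ : 𝒜.Ω) (w : ℝ³ → ℝ³) : ℝ³ → ℝ³ :=
  (𝒜.lam i θ) ^ (2 * 𝒜.σ - 3) •
    dilateField 𝒜.σ (𝒜.lam i θ)⁻¹ (rotateField (𝒜.R i θ).symm (multiplierApply (𝒜.m i θ) w))

/-- **The averaged Euler bilinear operator** `B̃ = 𝒜.op` of the datum `𝒜` (Tao 2016, Def. 1.2,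
(1.10)): the pointwise expectation
`B̃(u,v)(x) = 𝔼[(A₃† B(A₁ u, A₂ v))(x)] = ∫ (A₃(θ)† B(A₁(θ)u, A₂(θ)v))(x) dℙ(θ)`,
which is Tao's `⟨B̃(u,v), w⟩ = 𝔼⟨B(A₁u, A₂v), A₃w⟩` read through the formal adjoint
`slotAdjoint`. **Junk**: the chain of function-level Fourier integrals is honest for Schwartz
*divergence-free* `u v` (Tao's domain `H¹⁰_df` is divergence free; then `Aᵢu` is smooth,
divergence free with `O(|x|⁻³)` decay, `B(A₁u, A₂v) ∈ L¹ ∩ C^∞`, and every Bochner integral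
converges) and junk otherwise; moreover Bochner junk `0` where `θ ↦ (A₃† B(A₁u, A₂v))(x)` is
not `ℙ`-integrable (Tao's moment conditions, '?', are not encoded in `TaoAverageData`). [cite: Tao2016, Def. 1.2  (1.10] -/
def op (u v : ℝ³ → ℝ³) : ℝ³ → ℝ³ :=
  fun x => ∫ θ, 𝒜.slotAdjoint 2 θ (eulerBilinear (𝒜.slot 0 θ u) (𝒜.slot 1 θ v)) x ∂𝒜.P

/-- The datum with slots `0` and `1` exchanged; its operator is `(u, v) ↦ 𝒜.op v u`
(`op_swap`). [folklore] -/
def swap : TaoAverageData where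
  Ω := 𝒜.Ω
  P := 𝒜.P
  σ := 𝒜.σ
  m := ![𝒜.m 1, 𝒜.m 0, 𝒜.m 2]
  R := ![𝒜.R 1, 𝒜.R 0, 𝒜.R 2]
  lam := ![𝒜.lam 1, 𝒜.lam 0, 𝒜.lam 2]
  isOrderZeroSymbol i := by fin_cases i <;> exact 𝒜.isOrderZeroSymbol _
  lam_pos i := by fin_cases i <;> exact 𝒜.lam_pos _
  measurable_m i := by fin_cases i <;> exact 𝒜.measurable_m _
  measurable_R i := by fin_cases i <;> exact 𝒜.measurable_R _
  measurable_lam i := by fin_cases i <;> exact 𝒜.measurable_lam _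

/-- Exchanging slots `0` and `1` of the datum exchanges the arguments of the averaged operator
(symmetry of `B`, `eulerBilinear_symm`). [folklore] -/
theorem op_swap (u v : ℝ³ → ℝ³) : 𝒜.swap.op u v = 𝒜.op v u := by
  have h0 : ∀ θ : 𝒜.Ω, 𝒜.swap.slot 0 θ = 𝒜.slot 1 θ := fun _ => rfl
  have h1 : ∀ θ : 𝒜.Ω, 𝒜.swap.slot 1 θ = 𝒜.slot 0 θ := fun _ => rfl
  have h2 : ∀ θ : 𝒜.Ω, 𝒜.swap.slotAdjoint 2 θ = 𝒜.slotAdjoint 2 θ := fun _ => rfl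
  funext x
  simp only [op, h0, h1, h2, eulerBilinear_symm (𝒜.slot 1 _ u)]
  rfl

end TaoAverageData

/-- A bilinear operator on vector fields of `ℝ³` **is an averaged Euler bilinear operator**
(Tao 2016, Def. 1.2) if it is `𝒜.op` for some averaging datum `𝒜`. [cite: Tao2016, Def. 1.2] -/
def IsAveragedEulerBilinear (B : (ℝ³ → ℝ³) → (ℝ³ → ℝ³) → ℝ³ → ℝ³) : Prop :=
  ∃ 𝒜 : TaoAverageData, ∀ u v, B u v = 𝒜.op u v

/-- The class of averaged Euler bilinear operators is closed under exchanging the two arguments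
(exchange the random triples of slots `1` and `2` in Tao's (1.10) and use `B(u,v) = B(v,u)`). [folklore] -/
theorem IsAveragedEulerBilinear.symm {B : (ℝ³ → ℝ³) → (ℝ³ → ℝ³) → ℝ³ → ℝ³}
    (hB : IsAveragedEulerBilinear B) : IsAveragedEulerBilinear fun u v => B v u := by
  obtain ⟨𝒜, h𝒜⟩ := hB
  exact ⟨𝒜.swap, fun u v => show B v u = _ by rw [h𝒜, 𝒜.op_swap]⟩

/-- **The Euler bilinear operator itself is averaged** (Tao 2016, remark after Def. 1.2: take
`mᵢ ≡ 1`, `Rᵢ = id`, `λᵢ = 1` deterministically), on Schwartz divergence-free fields where the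
function-level multipliers are honest (`B(u,v) = -½ P div (u ⊗ v + v ⊗ u)` is then continuous,
`O(|x|⁻⁴)`, with integrable Fourier transform, so `1(D) B(u,v) = B(u,v)` by Fourier inversion):
there is a datum `𝒜` with `𝒜.op u v = B(u,v)` for all such `u v`. [cite: Tao2016, remark after Def. 1.2: take  mᵢ ≡ 1    R] -/
def exists_taoAverageData_op_eq_eulerBilinear : Prop :=
  ∃ 𝒜 : TaoAverageData, ∀ u v : ℝ³ → ℝ³, IsSchwartzField u → IsSchwartzField v →
      VectorCalculus.IsDivFree u → VectorCalculus.IsDivFree v → 𝒜.op u v = eulerBilinear u v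

end Tao

end Literature.Analysis.FluidPDE
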